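import Summits.QuantumFields.YangMills.Theorems.BalabanUVNodesN27SpineRecordJoinTuned
import Summits.QuantumFields.YangMills.Theorems.BalabanUVNodesN19LedgerLink

/-!
# BalabanUVNodes ∕ N27 spine-record join, VI — THE JOIN IN THE K5 LINK CURRENCY OF RECORD: node N19's in-edge content that is
# NOT a sibling's statement of record enters through dag-n19-b's landed ledger predicate `N19SizeWindow.LedgerAt` BY NAME
# (the record's «Link S R» clause), the N19 ∧ U4′ edge through `N19SizeWindow.core_summable_of_ledgerAt` BY NAME
# (cell `pub-ymgap`, HUMAN RULING D-0062 Track A, seat `pub-ymgap-dag-n27-a` g3; `--supports stmt-QuantumFields-19182`, count-neutral)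

WHY.  Files I∕III∕V of this seat (`hybridNE7Under_of_spineRecordAtDatum`, `…_sync`, `…_tuned`) spell the (2.25)-ledger link as a
13-conjunct hypothesis `hLink` under the targets' prefix.  dag-n19-b has since LANDED that conjunct list as ONE `Prop`-valued record
predicate `LedgerAt L l₀ vol T Bad A B R EA EB κ g uA uB ω θc θ₅ θ₃` over ONE data bundle `L : LedgerData C ι σ`
(`BalabanUVNodesN19LedgerLink`, tree 2026-08-26T00:28Z), and the plan owner's word of record ([YMPLAN-G61-DESK-1] (a)) is that the K5
stub typed after the rev-1 restate of `SpineGivenEndpoint` CITES `LedgerAt` ∕ `core_summable_of_ledgerAt` BY NAME («the record's Link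
clause ⊇ `LedgerAt`»).  THIS module re-bases the N27 join on that record predicate, so that the rev-1 glue «children → N27» is one line
over it: every hypothesis below is either a sibling node's statement of record (N16 in the minimal currency `LocalRate` + liaison, N18
`NE5`, N22 `NE9 ∧ FadingMemory`, N17's out-edge `U2Output D g₀` ∕ `InjectedRate`, N20 `RelWeightBound`, N21 `ShellWeightBound`), the
printed-grade argument bracket (`LipBackground`, `PolyLipGrowth`), the E1∕E2 dictionary, or `LedgerAt` — nothing else.  The ledger data
`L g₀ os` and hence the rate letters `θ′, Λg, a, E₀, m, Cw` may now vary with the string (files I–V took them uniform; dossier note T-3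
becomes moot).

WHAT IS KERNEL-CHECKED ([bookkeeping] ∕ [folklore]; 0 `def`, 0 `sorry`).
* §1 `stringHybridNE7_of_ledgerAt` — ONE STRING of one `TorusScheme`: `LedgerAt` on the SHELL-FREE cores `A − shA`, `B − shB` + the
  in-edges + N17's out-edge on the box + windows + N20 · N21 · `W + Wsh < 1` · E1∕E2 ⇒ `T4MatchingAssembly.StringHybridNE7 S os l₀ vol K₀`
  (`core_summable_of_ledgerAt` then file I's `stringHybridNE7_of_spineNodes_exists`).
* §2 `hybridNE7Under_of_ledgerAtDatum` — THE DATUM, raw run tables `runFlow D g₀ (K₀ + K)` (file I's form): TOP LEVEL N16∕N18∕N22∕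
  `LipBackground`; UNDER THE PREFIX `hU2` (the edge N17 → N27, `U2Output D g₀ Cd θc`), `hK5` (N20 · N21 · budget · E1∕E2 vs the genuine
  `schemeZ (D.scheme g₀) os (K₀+K)`), `hRuns` (`PolyLipGrowth` + both tables' window memberships), **`hLedger`** (`LedgerAt (L g₀ os) …` at
  the datum's runs); box READ OFF `Tuned` ⇒ `T4ApexHybrid.HybridNE7Under D Hβ`.
* §3 `hybridNE7Under_of_ledgerAtDatum_tuned` — THE DATUM, CLAMPED run tables `extd (prefixOf (runFlow D g₀ (K₀+K)) (K₀+K))` (file V's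
  form): box AND windows READ OFF `Tuned` (`hWin : Window γᵤ ⊆ Wset`), run-dependent K4 clause = `PolyLipGrowth` alone ⇒
  `T4ApexHybrid.HybridNE7Under D Hβ` — THE JOIN OF RECORD, v2 (Link by name).
* §4 `coreSummableUnder_of_ledgerAtDatum_tuned` — §3's antecedents minus K5∕E1∕E2 give, under the prefix, per string the N19 ∧ U4′
  edge `∃ δ, Spine.NE7.Core … δ ∧ Summable δ` at the clamped tables (the shape a rev-1 `S_N19`-facing stub consumes).

THE FIELD-BY-FIELD TABLE OF `T4MatchingAssembly.HybridNE7` (:146), REFRESHED 2026-08-26T00:50Z — delta over file I's table (2026-08-25T23:30Z)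
and the dossier §3 (00:00Z); «at D₀» = at NODE 00's datum of record (`Node00.Record5`∕`Record5C`∕`Record7` landed; `Record8` not yet; NOTHING
below is instantiated there):
* `weight` ← N20: + dag-n20-a `…N20KnitThreshold` p411645 (`relWeightBound_of_towerExtraction_threshold` ∕ `_at_floor`: N20 BY NAME at a tower
  record for EVERY admissible origin, resp. at the EXPLICIT origin `Sd.K₀ + ⌊2·log Sd.V ∕ log Sd.rq⁻¹⌋₊ + 1` — «pins, not guards»; reading note
  `N20-SREC5-ROWS.md`: `S.Bad` must be the budget's own saturated bad set), `…N20KnitLogCut` p412464 (log-cut twin).  At D₀: 0∕1.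
* `shell` ← N21: + dag-n21-a `…N21AveragingLower`, `…N21AveragingOscillation` (tree 00:08Z∕00:30Z).  At D₀: 0∕1.
* `lt_one`, `summable`: unchanged (U4′ tail ∕ delivered with `core`).
* `core` ← N19: + dag-n19-a `…N19ConstantsWindow` p412947 (v3′, τ-free reference ledger), `…N19ConstantsWindowU2Output`, `…N19OtherKindsU5b`
  p413531 (v4: other kinds through node U5b's `FactorLogRatio`); + dag-n19-b **`…N19LedgerLink`** (`LedgerData`, `LedgerAt`,
  `core_summable_of_ledgerAt` — CONSUMED HERE).  At D₀: 0∕1; the Link rows are NODE O content.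
* K4 producers: + n17-a `…N17KnitTransfer`, `…N17AtBetaOfRecord(Kernels)`; n18-a `…N18KingModel(Decay∕U3)`, `…N18TwoRunRecord`; n22-a
  `…N22KnitRecursion`, `…N22KnitFiniteTower`, `…N22KnitAnalytic`; n16-a `…N16Faces` p411575; n15-a∕-b +8 modules (defect kernels, Riemann wire).
* E1∕E2: unchanged — no producer (class expansion = NODE O ∕ `S_N27x`; rev-1 texts read densities over ₉C per R437).
* Q8 (road of record, default moment 2026-08-26T12:00Z): unchanged — default (a) `HistoryRealiseCellsRunApex.hybridNE7Under_of_countRoad`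
  concludes `B5lit`; g0 §5 `hybridNE7Under_of_literal` carries it to B5 under `BetaPertHyp`; the joins of this seat are road-agnostic at K5.

HONEST FRAMING.  COMPOSITE-node bookkeeping with the children's children as hypotheses: every analytic input is a HYPOTHESIS SHAPE of the
tree consumed BY NAME (NE3, NE4's out-edge, NE5, NE9, NE7b, NE7c — NONE printed for Bałaban's d = 4 procedure, NONE proved; `LedgerAt` is
NODE O content, dag-n19-b's typed record of it, not an estimate); nothing of Bałaban's objects is instantiated; NO node is discharged; (B)
and `Hβ` are antecedents, used, never refuted; one fixed finite four-torus — NOT ℝ⁴, NOT infinite volume, NOT OS axioms, NOT a mass gap,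
NOT Clay.  Typed 28∕28; the discharged count is not touched by this file.  No decl below carries a cite tag (locations are transcribed in
the imported modules' headers: [Balaban1988Convergent] (2.25) p. 259, Thm 2 (2.43) p. 263; [Balaban1987RG1] (0.26) p. 257).
-/

open Finset MeasureTheory

namespace Summit.QuantumFields.YangMills.Theorems.BalabanUVNodesN27SpineRecord

open Literature.MathematicalPhysics.QuantumFieldTheory.Balaban1983to89
open Literature.MathematicalPhysics.QuantumFieldTheory.Balaban1983to89.T4Continuum
open T4OutputRate T4RecentScale T4GoodClassBudget T4CauchySum T4TowerRateComposition T4TowerRateDischarge T4TermwiseBudget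
open T4WeightBudget (RelWeightBound)
open T4IndicatorShell (ShellWeightBound)
open T4MatchingAssembly (StringHybridNE7)
open T4EtaRateMin (Readings LocalRate)
open T4RateLiaison (GaugeDominated)
open T4ContinuumYM4Torus (ForSmallCouplings)
open T4FlagMemory (extd)
open FlowStep (prefixOf)
open Summit.QuantumFields.BalabanUV.T4Continuum.Spine
open Summit.QuantumFields.BalabanUV.T4Continuum.Spine.NE4 (U2Output runFlow)
open Summit.QuantumFields.YangMills.BalabanUVNodes.N19SizeWindow (LedgerData LedgerAt core_summable_of_ledgerAt)

/-! ## §1 One string: the ledger predicate + the in-edges + K5 ⇒ `StringHybridNE7` -/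

section Scheme

variable {G : Type*} [GaugeGroup G] [MeasurableSpace G] [HaarData G] {O : Type*}
  {C : Carriers} {ι X : Type} [MeasurableSpace ι] {σ : Type} [DecidableEq σ] {L : LedgerData C ι σ} {l₀ vol : ℝ}
  {T : ℕ → Finset σ} {Bad : ℕ → ℝ → Finset σ} {A B shA shB : ℕ → ℝ → σ → ℝ} {W Wsh : ℕ → ℝ}
  {R : Readings ι X} {Wset : Set (ℕ → ℝ)} {EA : Functional C C.BgA} {EB : Functional C C.BgB}
  {κ θ₅ C₅ C₉ ω θc Cd γ C₃ θ₃ P : ℝ} {q : ℕ} {Λm : ℕ → ℕ → ℝ} {CU : (ℕ → ℝ) → ℕ → ℝ} {g : ℕ → ℕ → ℝ}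
  {uA : ℕ → ι → C.BgA} {uB : ℕ → ι → C.BgB}

/-- **ONE STRING FROM THE LEDGER PREDICATE OF RECORD.**  Hypotheses: (K5) N20 `h20 : RelWeightBound`, N21 `h21 : ShellWeightBound`,
the budget `hlt`; (E) the E1∕E2 dictionary `hE1`, `hE2` against the string's dressed partition functions from cutoff `K₀` on; (Link)
**`hL : LedgerAt L l₀ vol T Bad (A − shA) (B − shB) R EA EB κ g uA uB ω θc θ₅ θ₃`** — dag-n19-b's record predicate ON THE SHELL-FREE
CORES, run A at cutoff `K₀ + K` with coupling table `g K`, run B re-indexed `i ↦ g (K+1) (i+1)`; (K4 in-edges by name) N22 `h22 : NE9 ∧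
FadingMemory`, node U3's bracket `hUL`, `hG`, N18 `h18 : NE5`, N16 in the minimal currency `hloc : LocalRate R C₃ θ₃` (+ liaison `hgd`);
(N17's out-edge) `hinj : InjectedRate Cd 0 θc (disc (g K) (g (K+1)))`, the box `hbox`, the window memberships `hgA`, `hgB`.
CONCLUSION: `StringHybridNE7 S os l₀ vol K₀`.  PROOF: `core_summable_of_ledgerAt` (ONE line) gives `∃ δ, Core ∧ Summable δ`; then
`stringHybridNE7_of_spineNodes_exists`.  CONDITIONAL on every binder; NE7∕NE7b∕NE7c NOT PRINTED, NOT proved. [bookkeeping] [folklore] -/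
theorem stringHybridNE7_of_ledgerAt (S : Missing.TorusScheme G O) (os : List O) (K₀ : ℕ)
    (h20 : RelWeightBound l₀ T A B Bad W) (h21 : ShellWeightBound l₀ T A B shA shB Wsh) (hlt : ∀ K, W K + Wsh K < 1)
    (hE1 : ∀ (K : ℕ) (t : ℝ), |t| ≤ l₀ → T4GenFunBounds.schemeZ S os (K₀ + K) t = ∑ τ ∈ T K, A K t τ)
    (hE2 : ∀ (K : ℕ) (t : ℝ), |t| ≤ l₀ → T4GenFunBounds.schemeZ S os (K₀ + K + 1) t = ∑ τ ∈ T K, B K t τ)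
    (hL : LedgerAt L l₀ vol T Bad (fun K t τ => A K t τ - shA K t τ) (fun K t τ => B K t τ - shB K t τ)
      R EA EB κ g uA uB ω θc θ₅ θ₃)
    (h22 : NE9 EA Wset κ Λm ∧ FadingMemory C₉ ω Λm) (hω : 0 ≤ ω)
    (hUL : LipBackground EA Wset κ CU) (hG : PolyLipGrowth CU g P q) (hP : 0 ≤ P)
    (h18 : NE5 EA EB Wset κ θ₅ C₅) (hθ₅ : 0 ≤ θ₅) (hC₅ : 0 ≤ C₅)
    (hloc : LocalRate R C₃ θ₃) (hC₃ : 0 ≤ C₃) (hθ₃ : 0 ≤ θ₃) (hθ₃1 : θ₃ < 1) (hgd : GaugeDominated R uA uB)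
    (hinj : InjectedRate Cd 0 θc (fun K j => T4CouplingMatching.disc (g K) (g (K + 1)) j)) (hCd : 0 ≤ Cd)
    (hθc : 0 ≤ θc) (hbox : ∀ K i, i ≤ K → 0 < g K i ∧ g K i ≤ γ)
    (hgA : ∀ K, g K ∈ Wset) (hgB : ∀ K, (fun i => g (K + 1) (i + 1)) ∈ Wset) :
    StringHybridNE7 S os l₀ vol K₀ :=
  stringHybridNE7_of_spineNodes_exists S os K₀ h20 h21 hlt
    (core_summable_of_ledgerAt hL h22.1 h22.2 hω hUL hG hP h18 hθ₅ hC₅ hloc hC₃ hθ₃ hθ₃1 hgd hinj hCd hθc hbox hgA hgB)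
    hE1 hE2

end Scheme

/-! ## §2 The datum, raw run tables: `LedgerAt` at the datum's runs `runFlow D g₀ (K₀ + K)` -/

section Datum

variable {F : T4Family} {G : Type*} [GaugeGroup G] [MeasurableSpace G] [HaarData G]
  {C : Carriers} {ι X : Type} [MeasurableSpace ι] {σ : Type} [DecidableEq σ]
  -- string-independent K4 data (the record decls' own letters)
  {R : Readings ι X} {Wset : Set (ℕ → ℝ)} {EA : Functional C C.BgA} {EB : Functional C C.BgB}
  {κ θ₅ C₅ C₉ ω C₃ θ₃ P γu : ℝ} {q : ℕ} {Λm : ℕ → ℕ → ℝ} {CU : (ℕ → ℝ) → ℕ → ℝ}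
  {uA : ℕ → ι → C.BgA} {uB : ℕ → ι → C.BgB}
  -- per-(tuned sequence, string) ledger data, K5 carriers, run tables
  {L : (ℕ → ℝ) → List (ULoop F) → LedgerData C ι σ}
  {l₀ vol : (ℕ → ℝ) → List (ULoop F) → ℝ} {K₀ : (ℕ → ℝ) → List (ULoop F) → ℕ}
  {g : (ℕ → ℝ) → List (ULoop F) → ℕ → ℕ → ℝ}
  {T : (ℕ → ℝ) → List (ULoop F) → ℕ → Finset σ} {Bad : (ℕ → ℝ) → List (ULoop F) → ℕ → ℝ → Finset σ}
  {A B shA shB : (ℕ → ℝ) → List (ULoop F) → ℕ → ℝ → σ → ℝ} {W Wsh : (ℕ → ℝ) → List (ULoop F) → ℕ → ℝ}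

/-- **N27 = B5 AT THE DATUM IN THE LINK CURRENCY OF RECORD — raw run tables** (any finite-`ε` datum `D`, any β-binder `Hβ`).  TOP
LEVEL, BY NAME: N16 in the minimal currency `hloc : LocalRate R C₃ θ₃` (what `NE3Shape.pointwise` ∕ dag-n16-a's faces deliver) + liaison
`hgd`, N18 `h18 : NE5 EA EB Wset κ θ₅ C₅`, N22 `h22 : NE9 EA Wset κ Λm ∧ FadingMemory C₉ ω Λm`, node U3's `hUL : LipBackground`, letter signs.
UNDER THE TARGETS' PREFIX (each its own `D.UnderHypotheses Hβ`, thresholds conjoined inside the proof): `hU2` — THE EDGE N17 → N27,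
`Spine.NE4.U2Output D g₀ Cd θc` (dag-n17-a's conclusion verbatim); `hK5` — per string, at the carriers of `(g₀, os)`: `0 < l₀`, `0 < vol`, N20
`RelWeightBound`, N21 `ShellWeightBound`, `W + Wsh < 1`, E1∕E2 against `T4GenFunBounds.schemeZ (D.scheme g₀) os (K₀ + K)` ∕ `(K₀ + K + 1)`;
`hRuns` — `PolyLipGrowth` and both run tables' window memberships AT THE DATUM'S RUNS `runFlow D g₀ (K₀ + K)`; **`hLedger` — dag-n19-b's
`LedgerAt (L g₀ os)` on the shell-free cores at those runs** (the whole (2.25)-ledger link of files I∕III as ONE record predicate).  The box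
`0 < runFlow D g₀ (K₀+K) i ≤ γ` (`i ≤ K`) is READ OFF `D.Tuned γ g g₀`.  CONCLUSION: `T4ApexHybrid.HybridNE7Under D Hβ` (= the venue's
`YMDAG.B5 D` at `Hβ := DagBinding.EndpointExistence D.C.toB12`).  PROOF: unfold the prefix, `ForSmallCouplings.and`, per tuned `g₀` and
string: `injectedRate_shift`, the box from `Tuned`, §1.  CONDITIONAL on every binder; nothing of Bałaban's instantiated; NOT a discharge.
[bookkeeping] [folklore] -/
theorem hybridNE7Under_of_ledgerAtDatum (D : FiniteEpsData F G) {Hβ : Prop} {Cd θc : ℝ}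
    (hloc : LocalRate R C₃ θ₃) (hC₃ : 0 ≤ C₃) (hθ₃ : 0 ≤ θ₃) (hθ₃1 : θ₃ < 1) (hgd : GaugeDominated R uA uB)
    (h18 : NE5 EA EB Wset κ θ₅ C₅) (hθ₅ : 0 ≤ θ₅) (hC₅ : 0 ≤ C₅)
    (h22 : NE9 EA Wset κ Λm ∧ FadingMemory C₉ ω Λm) (hω : 0 ≤ ω)
    (hUL : LipBackground EA Wset κ CU) (hP : 0 ≤ P) (hCd : 0 ≤ Cd) (hθc : 0 ≤ θc)
    (hU2 : D.UnderHypotheses Hβ fun g₀ => U2Output D g₀ Cd θc)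
    (hK5 : D.UnderHypotheses Hβ fun g₀ => ∀ os : List (ULoop F),
      0 < l₀ g₀ os ∧ 0 < vol g₀ os ∧
        RelWeightBound (l₀ g₀ os) (T g₀ os) (A g₀ os) (B g₀ os) (Bad g₀ os) (W g₀ os) ∧
        ShellWeightBound (l₀ g₀ os) (T g₀ os) (A g₀ os) (B g₀ os) (shA g₀ os) (shB g₀ os) (Wsh g₀ os) ∧
        (∀ K, W g₀ os K + Wsh g₀ os K < 1) ∧
        (∀ (K : ℕ) (t : ℝ), |t| ≤ l₀ g₀ os →
          T4GenFunBounds.schemeZ (D.scheme g₀) os (K₀ g₀ os + K) t = ∑ τ ∈ T g₀ os K, A g₀ os K t τ) ∧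
        (∀ (K : ℕ) (t : ℝ), |t| ≤ l₀ g₀ os →
          T4GenFunBounds.schemeZ (D.scheme g₀) os (K₀ g₀ os + K + 1) t = ∑ τ ∈ T g₀ os K, B g₀ os K t τ))
    (hRuns : D.UnderHypotheses Hβ fun g₀ => ∀ os : List (ULoop F),
      PolyLipGrowth CU (fun K => runFlow D g₀ (K₀ g₀ os + K)) P q ∧
        (∀ K, runFlow D g₀ (K₀ g₀ os + K) ∈ Wset) ∧
        (∀ K, (fun i => runFlow D g₀ (K₀ g₀ os + (K + 1)) (i + 1)) ∈ Wset))
    (hLedger : D.UnderHypotheses Hβ fun g₀ => ∀ os : List (ULoop F),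
      LedgerAt (L g₀ os) (l₀ g₀ os) (vol g₀ os) (T g₀ os) (Bad g₀ os)
        (fun K t τ => A g₀ os K t τ - shA g₀ os K t τ) (fun K t τ => B g₀ os K t τ - shB g₀ os K t τ)
        R EA EB κ (fun K => runFlow D g₀ (K₀ g₀ os + K)) uA uB ω θc θ₅ θ₃) :
    T4ApexHybrid.HybridNE7Under D Hβ := by
  intro hB hβ
  have H1 : ForSmallCouplings D _ := hU2 hB hβ
  have H2 : ForSmallCouplings D _ := hK5 hB hβ
  have H3 : ForSmallCouplings D _ := hRuns hB hβ
  have H4 : ForSmallCouplings D _ := hLedger hB hβ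
  obtain ⟨γ₀, hγ₀, Hγ⟩ := ((H1.and H2).and H3).and H4
  refine ⟨γ₀, hγ₀, fun γ hγ hγle => ?_⟩
  obtain ⟨g₁, hg₁, Hg⟩ := Hγ γ hγ hγle
  refine ⟨g₁, hg₁, fun gIR hgIR hgIRle g₀ ht os => ?_⟩
  obtain ⟨⟨⟨hu2, hk5⟩, hruns⟩, hledger⟩ := Hg gIR hgIR hgIRle g₀ ht
  obtain ⟨hl₀, hvol, h20, h21, hlt, hE1, hE2⟩ := hk5 os
  obtain ⟨hG, hgA, hgB⟩ := hruns os
  -- the box of both runs' tables, READ OFF `Tuned` at the run `K₀ + K`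
  have hbox : ∀ K i, i ≤ K →
      0 < runFlow D g₀ (K₀ g₀ os + K) i ∧ runFlow D g₀ (K₀ g₀ os + K) i ≤ γ := fun K i hi =>
    (ht (K₀ g₀ os + K)).1 i (hi.trans (Nat.le_add_left K (K₀ g₀ os)))
  -- N17's out-edge re-based at `K₀`
  have hinj : InjectedRate Cd 0 θc fun K j =>
      T4CouplingMatching.disc (runFlow D g₀ (K₀ g₀ os + K)) (runFlow D g₀ (K₀ g₀ os + (K + 1))) j :=
    injectedRate_shift hu2 (K₀ g₀ os)
  exact ⟨l₀ g₀ os, vol g₀ os, K₀ g₀ os, hl₀, hvol,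
    stringHybridNE7_of_ledgerAt (g := fun K => runFlow D g₀ (K₀ g₀ os + K)) (D.scheme g₀) os (K₀ g₀ os) h20 h21 hlt
      hE1 hE2 (hledger os) h22 hω hUL hG hP h18 hθ₅ hC₅ hloc hC₃ hθ₃ hθ₃1 hgd hinj hCd hθc hbox hgA hgB⟩

/-! ## §3 The datum, CLAMPED run tables: box AND windows READ OFF `Tuned` — the join of record, v2 (Link by name) -/

/-- **N27 = B5 AT THE DATUM, JOIN OF RECORD v2 — THE LINK CLAUSE BY NAME, CLAMPED RUN TABLES, BOX AND WINDOWS READ OFF `Tuned`.**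
As §2 EXCEPT: the two runs' coupling tables are a table map `g g₀ os K : ℕ → ℝ` PINNED by the defining hypothesis `hg` to the CLAMPED
run `extd (prefixOf (runFlow D g₀ (K₀+K)) (K₀+K))` (an instantiator supplies `hg := fun _ _ _ => rfl`); the record decls' coupling window
`Wset` contains `Window γᵤ` for some `γᵤ > 0` (`hWin`); the run-dependent K4 clause is `PolyLipGrowth` ALONE (`hG`); and `hLedger` is
dag-n19-b's `LedgerAt (L g₀ os)` on the shell-free cores AT THE CLAMPED TABLES.  Inside the proof the prefix's `γ`-threshold is shrunk to
`min γ₀ γᵤ`; for tuned `g₀` the box and BOTH window memberships follow from `D.Tuned γ g g₀` (file V §1: `extd_prefixOf_mem_window`,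
`extd_prefixOf_succ_mem_window`, `T4FlagMemoryTwoRun.extd_prefixOf`), and `hU2` transfers to the clamped tables (`injectedRate_clamped`).
CONCLUSION: `T4ApexHybrid.HybridNE7Under D Hβ`.  This is the form to cite: with the rev-1 record predicate's Link clause ⊇ `LedgerAt`, the
N27 glue «children → `YMDAG.B5 D`» is one line over it.  CONDITIONAL on every binder; nothing of Bałaban's instantiated; NOT a discharge.
[bookkeeping] [folklore] -/
theorem hybridNE7Under_of_ledgerAtDatum_tuned (D : FiniteEpsData F G) {Hβ : Prop} {Cd θc : ℝ}
    (hg : ∀ g₀ os K, g g₀ os K = extd (prefixOf (runFlow D g₀ (K₀ g₀ os + K)) (K₀ g₀ os + K)))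
    (hγu : 0 < γu) (hWin : Window γu ⊆ Wset)
    (hloc : LocalRate R C₃ θ₃) (hC₃ : 0 ≤ C₃) (hθ₃ : 0 ≤ θ₃) (hθ₃1 : θ₃ < 1) (hgd : GaugeDominated R uA uB)
    (h18 : NE5 EA EB Wset κ θ₅ C₅) (hθ₅ : 0 ≤ θ₅) (hC₅ : 0 ≤ C₅)
    (h22 : NE9 EA Wset κ Λm ∧ FadingMemory C₉ ω Λm) (hω : 0 ≤ ω)
    (hUL : LipBackground EA Wset κ CU) (hP : 0 ≤ P) (hCd : 0 ≤ Cd) (hθc : 0 ≤ θc)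
    (hU2 : D.UnderHypotheses Hβ fun g₀ => U2Output D g₀ Cd θc)
    (hK5 : D.UnderHypotheses Hβ fun g₀ => ∀ os : List (ULoop F),
      0 < l₀ g₀ os ∧ 0 < vol g₀ os ∧
        RelWeightBound (l₀ g₀ os) (T g₀ os) (A g₀ os) (B g₀ os) (Bad g₀ os) (W g₀ os) ∧
        ShellWeightBound (l₀ g₀ os) (T g₀ os) (A g₀ os) (B g₀ os) (shA g₀ os) (shB g₀ os) (Wsh g₀ os) ∧
        (∀ K, W g₀ os K + Wsh g₀ os K < 1) ∧
        (∀ (K : ℕ) (t : ℝ), |t| ≤ l₀ g₀ os →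
          T4GenFunBounds.schemeZ (D.scheme g₀) os (K₀ g₀ os + K) t = ∑ τ ∈ T g₀ os K, A g₀ os K t τ) ∧
        (∀ (K : ℕ) (t : ℝ), |t| ≤ l₀ g₀ os →
          T4GenFunBounds.schemeZ (D.scheme g₀) os (K₀ g₀ os + K + 1) t = ∑ τ ∈ T g₀ os K, B g₀ os K t τ))
    (hG : D.UnderHypotheses Hβ fun g₀ => ∀ os : List (ULoop F), PolyLipGrowth CU (g g₀ os) P q)
    (hLedger : D.UnderHypotheses Hβ fun g₀ => ∀ os : List (ULoop F),
      LedgerAt (L g₀ os) (l₀ g₀ os) (vol g₀ os) (T g₀ os) (Bad g₀ os)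
        (fun K t τ => A g₀ os K t τ - shA g₀ os K t τ) (fun K t τ => B g₀ os K t τ - shB g₀ os K t τ)
        R EA EB κ (g g₀ os) uA uB ω θc θ₅ θ₃) :
    T4ApexHybrid.HybridNE7Under D Hβ := by
  intro hB hβ
  have H1 : ForSmallCouplings D _ := hU2 hB hβ
  have H2 : ForSmallCouplings D _ := hK5 hB hβ
  have H3 : ForSmallCouplings D _ := hG hB hβ
  have H4 : ForSmallCouplings D _ := hLedger hB hβ
  obtain ⟨γ₀, hγ₀, Hγ⟩ := ((H1.and H2).and H3).and H4
  -- shrink the `γ`-threshold to `≤ γᵤ`, so that the tuned runs' window `Window γ` sits inside `Wset`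
  refine ⟨min γ₀ γu, lt_min hγ₀ hγu, fun γ hγ hγle => ?_⟩
  obtain ⟨g₁, hg₁, Hg⟩ := Hγ γ hγ (hγle.trans (min_le_left _ _))
  refine ⟨g₁, hg₁, fun gIR hgIR hgIRle g₀ ht os => ?_⟩
  obtain ⟨⟨⟨hu2, hk5⟩, hGg⟩, hledger⟩ := Hg gIR hgIR hgIRle g₀ ht
  obtain ⟨hl₀, hvol, h20, h21, hlt, hE1, hE2⟩ := hk5 os
  have hWγ : Window γ ⊆ Wset := fun h hh => hWin fun i => ⟨(hh i).1, (hh i).2.trans (hγle.trans (min_le_right _ _))⟩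
  -- the runs stay in `]0, γ]` (Tuned), so the clamped tables are in the window and in the box
  have hrun : ∀ K i, i ≤ K₀ g₀ os + K →
      0 < runFlow D g₀ (K₀ g₀ os + K) i ∧ runFlow D g₀ (K₀ g₀ os + K) i ≤ γ := fun K i hi => (ht (K₀ g₀ os + K)).1 i hi
  have hgA : ∀ K, g g₀ os K ∈ Wset := fun K => by
    rw [hg g₀ os K]; exact hWγ (extd_prefixOf_mem_window (hrun K))
  have hgB : ∀ K, (fun i => g g₀ os (K + 1) (i + 1)) ∈ Wset := fun K => by
    have e : (fun i => g g₀ os (K + 1) (i + 1))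
        = fun i => extd (prefixOf (runFlow D g₀ (K₀ g₀ os + (K + 1))) (K₀ g₀ os + (K + 1))) (i + 1) := by
      funext i; rw [hg g₀ os (K + 1)]
    rw [e]; exact hWγ (extd_prefixOf_succ_mem_window (hrun (K + 1)))
  have hbox : ∀ K i, i ≤ K → 0 < g g₀ os K i ∧ g g₀ os K i ≤ γ := fun K i hi => by
    rw [hg g₀ os K, T4FlagMemoryTwoRun.extd_prefixOf (show i ≤ K₀ g₀ os + K by omega)]
    exact hrun K i (by omega)
  have hinj : InjectedRate Cd 0 θc fun K j => T4CouplingMatching.disc (g g₀ os K) (g g₀ os (K + 1)) j :=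
    injectedRate_clamped D hu2 (K₀ g₀ os) (hg g₀ os)
  exact ⟨l₀ g₀ os, vol g₀ os, K₀ g₀ os, hl₀, hvol,
    stringHybridNE7_of_ledgerAt (g := g g₀ os) (D.scheme g₀) os (K₀ g₀ os) h20 h21 hlt hE1 hE2 (hledger os) h22 hω hUL
      (hGg os) hP h18 hθ₅ hC₅ hloc hC₃ hθ₃ hθ₃1 hgd hinj hCd hθc hbox hgA hgB⟩

/-! ## §4 The N19 ∧ U4′ edge alone, under the prefix, at the clamped tables (what a rev-1 `S_N19`-facing stub consumes) -/

/-- **THE N19 EDGE UNDER THE PREFIX, LINK BY NAME, CLAMPED TABLES.**  §3's antecedents WITHOUT K5 ∕ E1∕E2 (`hK5` dropped) give, under the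
targets' prefix and per string, node N19's decl of record with the `summable` leaf: `∃ δ, Spine.NE7.Core l₀ vol T Bad (A − shA) (B − shB) δ ∧
Summable δ` at the clamped tables — `core_summable_of_ledgerAt` transported under `D.UnderHypotheses Hβ` with the box and the windows read off
`Tuned` exactly as in §3.  This is the K4 ∧ Link ⇒ N19 edge in the shape the drafted K5 stub `S_N19` has (record ⇒ N19 under the prefix);
§3 = this + K5 + E1∕E2 via file I's `stringHybridNE7_of_spineNodes_exists`.  CONDITIONAL on every binder; NE7 NOT PRINTED, NOT proved.
[bookkeeping] [folklore] -/
theorem coreSummableUnder_of_ledgerAtDatum_tuned (D : FiniteEpsData F G) {Hβ : Prop} {Cd θc : ℝ}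
    (hg : ∀ g₀ os K, g g₀ os K = extd (prefixOf (runFlow D g₀ (K₀ g₀ os + K)) (K₀ g₀ os + K)))
    (hγu : 0 < γu) (hWin : Window γu ⊆ Wset)
    (hloc : LocalRate R C₃ θ₃) (hC₃ : 0 ≤ C₃) (hθ₃ : 0 ≤ θ₃) (hθ₃1 : θ₃ < 1) (hgd : GaugeDominated R uA uB)
    (h18 : NE5 EA EB Wset κ θ₅ C₅) (hθ₅ : 0 ≤ θ₅) (hC₅ : 0 ≤ C₅)
    (h22 : NE9 EA Wset κ Λm ∧ FadingMemory C₉ ω Λm) (hω : 0 ≤ ω)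
    (hUL : LipBackground EA Wset κ CU) (hP : 0 ≤ P) (hCd : 0 ≤ Cd) (hθc : 0 ≤ θc)
    (hU2 : D.UnderHypotheses Hβ fun g₀ => U2Output D g₀ Cd θc)
    (hG : D.UnderHypotheses Hβ fun g₀ => ∀ os : List (ULoop F), PolyLipGrowth CU (g g₀ os) P q)
    (hLedger : D.UnderHypotheses Hβ fun g₀ => ∀ os : List (ULoop F),
      LedgerAt (L g₀ os) (l₀ g₀ os) (vol g₀ os) (T g₀ os) (Bad g₀ os)
        (fun K t τ => A g₀ os K t τ - shA g₀ os K t τ) (fun K t τ => B g₀ os K t τ - shB g₀ os K t τ)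
        R EA EB κ (g g₀ os) uA uB ω θc θ₅ θ₃) :
    D.UnderHypotheses Hβ fun g₀ => ∀ os : List (ULoop F), ∃ δ : ℕ → ℝ,
      NE7.Core (l₀ g₀ os) (vol g₀ os) (T g₀ os) (Bad g₀ os)
        (fun K t τ => A g₀ os K t τ - shA g₀ os K t τ) (fun K t τ => B g₀ os K t τ - shB g₀ os K t τ) δ ∧ Summable δ := by
  intro hB hβ
  have H1 : ForSmallCouplings D _ := hU2 hB hβ
  have H3 : ForSmallCouplings D _ := hG hB hβ
  have H4 : ForSmallCouplings D _ := hLedger hB hβ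
  obtain ⟨γ₀, hγ₀, Hγ⟩ := (H1.and H3).and H4
  refine ⟨min γ₀ γu, lt_min hγ₀ hγu, fun γ hγ hγle => ?_⟩
  obtain ⟨g₁, hg₁, Hg⟩ := Hγ γ hγ (hγle.trans (min_le_left _ _))
  refine ⟨g₁, hg₁, fun gIR hgIR hgIRle g₀ ht os => ?_⟩
  obtain ⟨⟨hu2, hGg⟩, hledger⟩ := Hg gIR hgIR hgIRle g₀ ht
  have hWγ : Window γ ⊆ Wset := fun h hh => hWin fun i => ⟨(hh i).1, (hh i).2.trans (hγle.trans (min_le_right _ _))⟩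
  have hrun : ∀ K i, i ≤ K₀ g₀ os + K →
      0 < runFlow D g₀ (K₀ g₀ os + K) i ∧ runFlow D g₀ (K₀ g₀ os + K) i ≤ γ := fun K i hi => (ht (K₀ g₀ os + K)).1 i hi
  have hgA : ∀ K, g g₀ os K ∈ Wset := fun K => by
    rw [hg g₀ os K]; exact hWγ (extd_prefixOf_mem_window (hrun K))
  have hgB : ∀ K, (fun i => g g₀ os (K + 1) (i + 1)) ∈ Wset := fun K => by
    have e : (fun i => g g₀ os (K + 1) (i + 1))
        = fun i => extd (prefixOf (runFlow D g₀ (K₀ g₀ os + (K + 1))) (K₀ g₀ os + (K + 1))) (i + 1) := by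
      funext i; rw [hg g₀ os (K + 1)]
    rw [e]; exact hWγ (extd_prefixOf_succ_mem_window (hrun (K + 1)))
  have hbox : ∀ K i, i ≤ K → 0 < g g₀ os K i ∧ g g₀ os K i ≤ γ := fun K i hi => by
    rw [hg g₀ os K, T4FlagMemoryTwoRun.extd_prefixOf (show i ≤ K₀ g₀ os + K by omega)]
    exact hrun K i (by omega)
  have hinj : InjectedRate Cd 0 θc fun K j => T4CouplingMatching.disc (g g₀ os K) (g g₀ os (K + 1)) j :=
    injectedRate_clamped D hu2 (K₀ g₀ os) (hg g₀ os)
  exact core_summable_of_ledgerAt (hledger os) h22.1 h22.2 hω hUL (hGg os) hP h18 hθ₅ hC₅ hloc hC₃ hθ₃ hθ₃1 hgd hinj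
    hCd hθc hbox hgA hgB

end Datum

end Summit.QuantumFields.YangMills.Theorems.BalabanUVNodesN27SpineRecord
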